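import Summits.BirchSwinnertonDyer.Rank1Residual.Supersingular.X8PrintDischargeSmallImage
import Literature.NumberTheory.EllipticCurves.SerreOpenImageSupersingularFrobeniusProofs
import Literature.NumberTheory.EllipticCurves.DivisionFieldRamificationProofs
import Literature.NumberTheory.IwasawaTheory.ClassicalMuInvariantOnePrimeProofs
import HarnessLib

/-!
# Cell bsd-print-x8 (D-0131 (2) PRINT TIER), seat ty2 — DISCHARGE INTERFACE §7: on the small-image
# sub-leaf X8 ∩ {¬ surj(3)} the division field `ℚ(E[3])` has EXACTLY ONE prime above `3`
# (`e = 8`, `f = 2`, `g = 1`) — the `hv` binder of Iwasawa's 1956 theorem on the Conj-A road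

HONEST FRAMING (cell `bsd-print-x8`, `run/shared/lean/pub/bsd-print-x8/`): seat ty2 = «leaf predicate
⟹ the cited theorem's hypotheses, sorry-free (Summits side), so provers close by name».  THEOREMS ONLY
(no definition, no named fact, nothing asserted about BSD).  Sequel of `X8PrintDischargeSmallImage` (§6:
on X8 ∧ ¬ surj the mod-`3` image is EXACTLY `C_ns⁺(3)`, order `16`).

WHAT IS DISCHARGED.  Prover p2 g2's Conj-A road to the μ-child of crux 20402 (item 20622
`MuBoundSmallImageX8`; `Theorems/PrintX8SmallImageMuBoundConjA.lean`,
`PrintX8MuBoundConjA.conjA_of_not_dvd_classNumber_of_unique_prime hCS W p hp hh hv`; TURNKEY to ty2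
16:29:30Z): statement (A) of Coates–Sujatha at `(E, 3)` ⟸ classical Iwasawa `μ = 0` for the cyclotomic
tower of `L = ℚ(E[3])` (tree fact
`CoatesSujatha2005.thm34_fineSelmerDual_moduleFinite_of_classicalMuVanishes_divisionField`) ⟸ Iwasawa 1956
(tree THEOREM `IwasawaTheory.iwasawa1956_…_holds`: «`p ∤ h_K` and EXACTLY ONE prime of `K` over `p` ⟹
`A_n = 0` up every `ℤ_p`-tower»).  Of Iwasawa's two hypotheses at `K = ℚ(E[3])`, `hh : 3 ∤ h(ℚ(E[3]))`
is a per-cell certificate (degree-16 class numbers, p2/ty3 kit lane); the other, `hv` —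

  `∃! w : HeightOneSpectrum (𝓞 ℚ(E[3])), 3 ∈ w`

— is STRUCTURAL on the 61-cell sub-leaf and is proved here, binder-free from `ClassX8 W p ∧ ¬ Surj W p`:

* §7a `card_range_galoisRepTorsion_of_goodSS_of_not_surj` — `#ρ̄_{E,p}(Γ_ℚ) = 2(p² − 1)` at an odd
  good supersingular non-surjective prime (`= #N(C_ns)`; the frame form of cell b2b-bsdres's
  `GaloisImage.map_range_eq_normalizer_unitGroup_of_goodSS_of_not_surj` + Serre §2.2 `(N : C) = 2`);
  `card_aut_divisionField_eq_card_range` (`#Gal(ℚ(E[p])/ℚ) = #ρ̄(Γ_ℚ)`) and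
  `not_dvd_card_aut_divisionField_of_goodSS_of_not_surj` (`p ∤ #Gal(ℚ(E[p])/ℚ) = 2(p² − 1)`).
* §7b `exists_map_stabilizer_galoisRepTorsion_eq_range` — **`ρ̄(D_𝔓) = ρ̄(Γ_ℚ)`**: the decomposition
  group of a prime `𝔓 ∣ p` of `\bar ℤ` already has the full image (Serre 1972 Prop. 12 d): `ρ̄(D_𝔓) =
  N ⊋ C = ρ̄(I_𝔓)`, the Literature theorem
  `exists_mem_stabilizer_galoisRepTorsion_not_mem_map_inertia`; `#C = p² − 1`, `#ρ̄(Γ_ℚ) = 2(p² − 1)`).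
* §7c `existsUnique_prime_divisionField_of_goodSS_of_not_surj` — **exactly one prime of `𝓞 ℚ(E[p])`
  contains `p`** (`Gal(ℚ(E[p])/ℚ) = D`, transitivity of the Galois action on the primes over `p`,
  Mathlib `Algebra.IsInvariant.exists_smul_of_under_eq`); in the spelling of the `hv` binder of
  `iwasawa1956_classNumberPExp_eq_zero_of_not_dvd_classNumber_of_unique_prime` at `K := W.divisionField p`.
* §7d AT THE LEAF (p2 g2's TURNKEY (a)/(b), 16:29:30Z): (a) `ClassX8.existsUnique_prime_divisionField_of_not_surj`
  — so `PrintX8MuBoundConjA.conjA_of_not_dvd_classNumber_of_unique_prime hCS W p hp hh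
  (ClassX8.existsUnique_prime_divisionField_of_not_surj W p hX hns)` is (A) at the pair from ONE integer
  `hh`; `ClassX8.classicalMuVanishes_divisionField_of_not_surj_of_not_dvd_classNumber` (Iwasawa 1956
  applied: `3 ∤ h(ℚ(E[3]))` ⟹ classical `μ = 0` for EVERY `ℤ₃`-extension of `ℚ(E[3])`, the hypothesis of
  the CS05 fact verbatim); (b) `ClassX8.card_aut_divisionField_of_not_surj` (`#Gal(ℚ(E[3])/ℚ) = 16`) and
  `ClassX8.not_dvd_card_aut_divisionField_of_not_surj` (`3 ∤ #Gal`, Deo–Ray–Sujatha's (c1)).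

NOT CLAIMED: (A) itself on any cell (the class numbers `h(ℚ(E[3]))` are certificates to be computed: p2
g2's kit j283348); anything on the 156 surjective cells (there `ρ̄(D_𝔓) = C_ns⁺(3) ⊊ GL₂(𝔽₃)`: THREE
primes above `3`, and Iwasawa's `hv` FAILS).
Table of record: HOME/TY2-DISCHARGE-TABLE.md §I.  cells: 0.  beyond-print theorem: no (Serre 1972
Prop. 12 c), d), p. 275; Iwasawa 1956; Coates–Sujatha 2005 Thm. 3.4).

## References

* [Serre1972] J.-P. Serre, Invent. Math. 15 (1972) 259–331, §1.11 Prop. 12 (p. 275) c) «L'image de `I`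
  dans `GL(E_p)` est un groupe cyclique `C` d'ordre `p² − 1`» and d) «L'image de `G` dans `GL(E_p)` est
  égale à `C` ou au normalisateur `N` de `C` suivant que `k` contient ou ne contient pas `F_{p²}`»
  (over `ℚ_p`: `k = F_p`, image `N`); §1.9 Prop. 9 Cor. 2 (p. 270); §2.2.
* [Greenberg2001IwasawaPastPresent] R. Greenberg, *Iwasawa theory — past and present*, Prop. 2.1.
* [CoatesSujatha2005] J. Coates, R. Sujatha, Math. Ann. 331 (2005), Thm. 3.4 (via the tree fact).
* [DeoRaySujatha2023] S. V. Deo, A. Ray, R. Sujatha, PAMQ 19 (2023), Thm. 3.8/3.9, Lemma 5.1 ((c1)).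
* [NeukirchANT1999] J. Neukirch, *Algebraic Number Theory*, Ch. I §9 (9.1)–(9.6).
* [SilvermanAEC2009] J. H. Silverman, *The Arithmetic of Elliptic Curves*, III.§7, VIII.§1.
-/

noncomputable section

open scoped Classical NumberField Pointwise
open Field IsDedekindDomain NumberField WeierstrassCurve Rat.HeightOneSpectrum
  Literature.NumberTheory.EllipticCurves Literature.NumberTheory.GaloisRepresentations
  Literature.NumberTheory.GaloisRepresentations.Serre1972
  Literature.NumberTheory.EllipticCurves.Rank1Residual
  Literature.NumberTheory.EllipticCurves.Rank1Residual.Typed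
  Literature.NumberTheory.SerreUniformity Literature.NumberTheory.IwasawaTheory

namespace Summit.BirchSwinnertonDyer.Rank1Residual.Supersingular

variable (W : WeierstrassCurve ℚ) [W.IsElliptic] [W.IsGloballyMinimal] (p : ℕ) [Fact p.Prime]

/-! ### §7a. The order of the image at an odd good supersingular non-surjective prime -/

/-- **`#ρ̄_{E,p}(Γ_ℚ) = 2(p² − 1)` at an odd prime of good supersingular reduction with `ρ̄_{E,p}` not
onto**: the image is the full normaliser `N(kˣ)` of a non-split Cartan subgroup
(`GaloisImage.map_range_eq_normalizer_unitGroup_of_goodSS_of_not_surj`), `#kˣ = p² − 1`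
(`Serre1972.card_unitGroup_eq`) and `(N : kˣ) = 2` (`Serre1972.relIndex_normalizer_eq_two`).
[cite: Serre1972, §1.11 Prop. 12, §2.2] -/
theorem card_range_galoisRepTorsion_of_goodSS_of_not_surj (hp2 : p ≠ 2) (hss : GoodSS W p)
    (hns : ¬ Surj W p) : Nat.card (galoisRepTorsion W p).range = 2 * (p ^ 2 - 1) := by
  obtain ⟨e, Φ, he, -⟩ := exists_frame_galoisRepTorsion_rat W p
  obtain ⟨k, hk, h2, hG⟩ :=
    GaloisImage.map_range_eq_normalizer_unitGroup_of_goodSS_of_not_surj W p Φ e he hp2 hss hns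
  set C : Subgroup (GL (Fin 2) (ZMod p)) := unitGroup k with hCdef
  set N : Subgroup (GL (Fin 2) (ZMod p)) :=
    Subgroup.normalizer (unitGroup k : Set (GL (Fin 2) (ZMod p))) with hNdef
  have hC : C ∈ cartanSubgroups (ZMod p) := unitGroup_mem_cartanSubgroups hk h2
  have h2i : C.relIndex N = 2 := relIndex_normalizer_eq_two hC (fun _ ↦ hp2)
  have hCcard : Nat.card C = p ^ 2 - 1 := card_unitGroup_eq hk h2
  have hCN : C ≤ N := Subgroup.le_normalizer
  have hNcard : Nat.card N = 2 * (p ^ 2 - 1) := by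
    have h := Subgroup.card_mul_index (C.subgroupOf N)
    rw [Nat.card_congr (Subgroup.subgroupOfEquivOfLe hCN).toEquiv, hCcard] at h
    change (p ^ 2 - 1) * C.relIndex N = Nat.card N at h
    rw [h2i] at h
    omega
  rw [← hNcard, ← hG]
  exact (Subgroup.card_map_of_injective Φ.injective).symm

omit [W.IsGloballyMinimal] in
/-- **`#Gal(ℚ(E[p])/ℚ) = #ρ̄_{E,p}(Γ_ℚ)`**: the division field is the fixed field of `ker ρ̄_{E,p}`
(`fixingSubgroup_divisionField`), so `[ℚ(E[p]) : ℚ] = (ker ρ̄ : Γ_ℚ) = #ρ̄(Γ_ℚ)` and `ℚ(E[p])/ℚ` is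
Galois. [cite: SilvermanAEC2009, III.§7 and VIII.§1] -/
theorem card_aut_divisionField_eq_card_range :
    Nat.card (W.divisionField p ≃ₐ[ℚ] W.divisionField p) = Nat.card (galoisRepTorsion W p).range := by
  haveI : NeZero p := ⟨(Fact.out : p.Prime).ne_zero⟩
  -- the `ℚ`-algebra structure elaboration finds on `ℚ(E[p])` is `DivisionRing.toRatAlgebra` (defeq,
  -- not reducibly, to the subfield's own): restate the tree's instances at that structure
  haveI : FiniteDimensional ℚ (W.divisionField p) := W.finiteDimensional_divisionField p
  haveI : IsGalois ℚ (W.divisionField p) := W.isGalois_divisionField p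
  have h1 : Module.finrank ℚ (W.divisionField p) = (W.divisionField p).fixingSubgroup.index :=
    IntermediateField.finrank_eq_fixingSubgroup_index _
  have h2 : ((W.divisionField p).fixingSubgroup : Subgroup (absoluteGaloisGroup ℚ)) =
      (galoisRepTorsion W p).ker := by
    rw [W.fixingSubgroup_divisionField p]
    ext σ
    rw [W.mem_fixingSubgroupOfModule_geomTorsion_iff p, MonoidHom.mem_ker, galoisRepTorsion_eq_one_iff']
  rw [IsGalois.card_aut_eq_finrank, h1, h2]
  exact Subgroup.index_ker (galoisRepTorsion W p)

/-- **`p ∤ #Gal(ℚ(E[p])/ℚ)` at an odd good supersingular prime with `ρ̄_{E,p}` not onto**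
(`#Gal = 2(p² − 1)`).  This is hypothesis (c1) of Deo–Ray–Sujatha 2023 Thm. 3.8 in Lemma 5.1's form
«the order of `G` is coprime to `p`» (tree fact `DeoRaySujatha2023.thm39_…`, binder `p ∤ #Gal`).
[cite: Serre1972, §1.11 Prop. 12, §2.2] [cite: DeoRaySujatha2023, §5 Lemma 5.1 (p. 17)] -/
theorem not_dvd_card_aut_divisionField_of_goodSS_of_not_surj (hp2 : p ≠ 2) (hss : GoodSS W p)
    (hns : ¬ Surj W p) : ¬ p ∣ Nat.card (W.divisionField p ≃ₐ[ℚ] W.divisionField p) := by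
  have hp : p.Prime := Fact.out
  rw [card_aut_divisionField_eq_card_range,
    card_range_galoisRepTorsion_of_goodSS_of_not_surj W p hp2 hss hns]
  intro h
  rcases (Nat.Prime.dvd_mul hp).mp h with h2 | h1
  · exact hp2 ((Nat.prime_dvd_prime_iff_eq hp Nat.prime_two).mp h2)
  · have hpp : p ∣ p ^ 2 := dvd_pow_self p two_ne_zero
    have h1le : 1 ≤ p ^ 2 := Nat.one_le_pow _ _ hp.pos
    have h3 : p ∣ (p ^ 2 - 1) + 1 := by rw [Nat.sub_add_cancel h1le]; exact hpp
    exact hp.one_lt.ne' (Nat.dvd_one.mp ((Nat.dvd_add_right h1).mp h3))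

/-! ### §7b. The decomposition group already has the full image (Serre Prop. 12 d)) -/

/-- **`ρ̄_{E,p}(D_𝔓) = ρ̄_{E,p}(Γ_ℚ)` at an odd good supersingular prime with `ρ̄_{E,p}` not onto.**
For the place `v ∣ p` of `ℚ` there is a prime `𝔓` of `\bar ℤ` above `v` whose decomposition group
`D_𝔓 = Stab(𝔓) ≤ Γ_ℚ` maps ONTO the image: `ρ̄(I_𝔓)` has order `p² − 1`
(Serre Prop. 12 c)), `ρ̄(D_𝔓) ⊋ ρ̄(I_𝔓)` (Prop. 12 d), Literature
`exists_mem_stabilizer_galoisRepTorsion_not_mem_map_inertia`), and `#ρ̄(Γ_ℚ) = 2(p² − 1)` (§7a); so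
`#ρ̄(D_𝔓) = 2(p² − 1)`.  [cite: Serre1972, §1.11 Prop. 12 c), d) (p. 275)] -/
theorem exists_map_stabilizer_galoisRepTorsion_eq_range (hp2 : p ≠ 2) (hss : GoodSS W p)
    (hns : ¬ Surj W p) {v : HeightOneSpectrum (𝓞 ℚ)} (hv : ((p : ℕ) : 𝓞 ℚ) ∈ v.asIdeal) :
    ∃ 𝔓 ∈ v.primesAbove, (MulAction.stabilizer (absoluteGaloisGroup ℚ) 𝔓).map (galoisRepTorsion W p) =
      (galoisRepTorsion W p).range := by
  have hp : p.Prime := Fact.out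
  have hveq : v = primesEquiv.symm ⟨p, hp⟩ := (natCast_mem_asIdeal_iff_eq_primesEquiv_symm v hp).mp hv
  have hvp : (primesEquiv v : ℕ) = p := by rw [hveq, Equiv.apply_symm_apply]
  have hΔ : ¬ (p : ℤ) ∣ minimalDiscriminantInt W :=
    W.not_dvd_minimalDiscriminantInt_of_hasGoodReductionAtPrime' p hss.1
  obtain ⟨𝔓, h𝔓, φ, hφD, hφnot, -, hcard⟩ :=
    exists_mem_stabilizer_galoisRepTorsion_not_mem_map_inertia p hΔ hss.2 hp2 hvp
  refine ⟨𝔓, h𝔓, ?_⟩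
  set ρ := galoisRepTorsion W p with hρ
  set I := 𝔓.inertia (absoluteGaloisGroup ℚ) with hI
  set n := p ^ 2 - 1 with hn
  have hnpos : 0 < n := Nat.sub_pos_of_lt (Nat.one_lt_pow two_ne_zero hp.one_lt)
  have h1 : I.map ρ ≤ (MulAction.stabilizer (absoluteGaloisGroup ℚ) 𝔓).map ρ :=
    Subgroup.map_mono fun σ hσ ↦ 𝔓.inertia_le_stabilizer hσ
  have h2 : (MulAction.stabilizer (absoluteGaloisGroup ℚ) 𝔓).map ρ ≤ ρ.range :=
    Subgroup.map_le_range ρ _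
  have hR : Nat.card ρ.range = 2 * n := card_range_galoisRepTorsion_of_goodSS_of_not_surj W p hp2 hss hns
  haveI : Finite ρ.range := Nat.finite_of_card_ne_zero (by rw [hR]; omega)
  haveI : Finite ((MulAction.stabilizer (absoluteGaloisGroup ℚ) 𝔓).map ρ) :=
    Finite.of_injective _ (Subgroup.inclusion_injective h2)
  obtain ⟨a, ha⟩ := Subgroup.card_dvd_of_le h1
  obtain ⟨b, hb⟩ := Subgroup.card_dvd_of_le h2
  rw [hcard] at ha
  rw [ha, hR] at hb
  -- `n * a * b = 2 * n`, so `a ∣ 2`; `a ≠ 1` because `ρ φ ∈ ρ(D) ∖ ρ(I)`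
  have hab : a * b = 2 := by
    have : n * (a * b) = n * 2 := by rw [← mul_assoc, ← hb, mul_comm]
    exact Nat.eq_of_mul_eq_mul_left hnpos this
  have ha1 : a ≠ 1 := by
    intro ha1
    rw [ha1, mul_one, ← hcard] at ha
    have hIeqD : I.map ρ = (MulAction.stabilizer (absoluteGaloisGroup ℚ) 𝔓).map ρ :=
      Subgroup.eq_of_le_of_card_ge h1 ha.le
    exact hφnot (hIeqD ▸ Subgroup.mem_map_of_mem ρ hφD)
  have ha2 : a = 2 := by
    have hdvd : a ∣ 2 := Dvd.intro b hab
    rcases (Nat.dvd_prime Nat.prime_two).mp hdvd with h | h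
    · exact absurd h ha1
    · exact h
  refine Subgroup.eq_of_le_of_card_ge h2 ?_
  rw [hR, ha, ha2, mul_comm]

/-! ### §7c. Exactly one prime of the division field above `p` -/

/-- **Exactly one prime of `𝓞 ℚ(E[p])` lies above `p`, at an odd good supersingular prime `p` with
`ρ̄_{E,p}` not onto** (`e = p² − 1`, `f = 2`, `g = 1`).  With `𝔓 ∣ p` as in §7b and
`P = 𝔓 ∩ 𝓞 L`, `L = ℚ(E[p])`: every `g ∈ Gal(L/ℚ)` is the restriction of some `d ∈ D_𝔓` (§7b and
`ker(Γ_ℚ → Gal(L/ℚ)) = ker ρ̄_{E,p}`, `absRestrictNormalHom_divisionField_eq_one_iff`), so `g • P = P`;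
and `Gal(L/ℚ)` is transitive on the primes of `𝓞 L` over `p` (Mathlib
`Algebra.IsInvariant.exists_smul_of_under_eq`).  Spelled as the `hv` binder of
`IwasawaTheory.iwasawa1956_classNumberPExp_eq_zero_of_not_dvd_classNumber_of_unique_prime` at
`K := W.divisionField p`. [cite: Serre1972, §1.11 Prop. 12 d) (p. 275)] [cite: NeukirchANT1999, Ch. I §9 (9.1)] -/
theorem existsUnique_prime_divisionField_of_goodSS_of_not_surj (hp2 : p ≠ 2) (hss : GoodSS W p)
    (hns : ¬ Surj W p) :
    ∃! w : HeightOneSpectrum (𝓞 (W.divisionField p)),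
      ((p : ℕ) : 𝓞 (W.divisionField p)) ∈ w.asIdeal := by
  have hp : p.Prime := Fact.out
  haveI : NeZero p := ⟨hp.ne_zero⟩
  set L := W.divisionField p with hL
  haveI : FiniteDimensional ℚ L := W.finiteDimensional_divisionField p
  haveI : IsGalois ℚ L := W.isGalois_divisionField p
  haveI : NumberField L := NumberField.mk
  -- restriction `Γ_ℚ → Gal(L/ℚ)` is onto and compatible with the inclusion `L ⊆ ℚ̄` (the `Normal`
  -- instance of `ℚ̄/ℚ` is keyed on `AlgebraicClosure.instAlgebra`, not on `DivisionRing.toRatAlgebra`)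
  haveI : Normal ℚ (AlgebraicClosure ℚ) :=
    @IsAlgClosure.normal ℚ (AlgebraicClosure ℚ) _ _ (AlgebraicClosure.instAlgebra ℚ) inferInstance
  have hsurj : Function.Surjective (absRestrictNormalHom L) := fun g ↦ by
    obtain ⟨σ, hσ⟩ := AlgEquiv.restrictNormalHom_surjective (AlgebraicClosure ℚ) g
    exact ⟨(Field.absoluteGaloisGroup.toAlgEquiv ℚ).symm σ, hσ⟩
  have hcoe : ∀ (σ : absoluteGaloisGroup ℚ) (x : L),
      ((absRestrictNormalHom L σ x : L) : AlgebraicClosure ℚ) = σ • (x : AlgebraicClosure ℚ) :=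
    fun σ x ↦ AlgEquiv.restrictNormal_commutes (absoluteGaloisGroup.toAlgEquiv ℚ σ) L x
  -- the place of `ℚ` at `p`, the prime `𝔓 ∣ p` of `\bar ℤ` of §7b and `P = 𝔓 ∩ 𝓞 L`
  set v : HeightOneSpectrum (𝓞 ℚ) := primesEquiv.symm ⟨p, hp⟩ with hvdef
  have hv : ((p : ℕ) : 𝓞 ℚ) ∈ v.asIdeal := (natCast_mem_asIdeal_iff_eq_primesEquiv_symm v hp).mpr rfl
  obtain ⟨𝔓, h𝔓, hD⟩ := exists_map_stabilizer_galoisRepTorsion_eq_range W p hp2 hss hns hv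
  haveI : 𝔓.IsPrime := h𝔓.1
  haveI : 𝔓.LiesOver v.asIdeal := h𝔓.2
  set ι := ringOfIntegersToIntegralClosure (k := ℚ) (Ω := AlgebraicClosure ℚ) L with hι
  set P : Ideal (𝓞 L) := 𝔓.comap ι with hPdef
  haveI hPprime : P.IsPrime := Ideal.comap_isPrime _ 𝔓
  haveI hPover : P.LiesOver v.asIdeal :=
    @comap_ringOfIntegersToIntegralClosure_liesOver ℚ _ L v 𝔓 h𝔓.2
  have hpP : ((p : ℕ) : 𝓞 L) ∈ P := by
    have h := hv
    rw [hPover.over, Ideal.under_def, Ideal.mem_comap, map_natCast] at h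
    exact h
  have hP0 : P ≠ ⊥ := fun h ↦ by
    rw [h, Ideal.mem_bot] at hpP
    exact hp.ne_zero (by exact_mod_cast hpP)
  -- every `g ∈ Gal(L/ℚ)` stabilises `P`
  have key : ∀ g : L ≃ₐ[ℚ] L, ∀ x ∈ P, g • x ∈ P := by
    intro g x hx
    obtain ⟨σ, rfl⟩ := hsurj g
    -- `ρ σ = ρ d` for some `d ∈ D_𝔓`
    have hσ : galoisRepTorsion W p σ ∈ (MulAction.stabilizer (absoluteGaloisGroup ℚ) 𝔓).map
        (galoisRepTorsion W p) := by rw [hD]; exact ⟨σ, rfl⟩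
    obtain ⟨d, hdD, hd⟩ := hσ
    have hker : absRestrictNormalHom L (d⁻¹ * σ) = 1 := by
      rw [absRestrictNormalHom_divisionField_eq_one_iff]
      exact (galoisRepTorsion_eq_one_iff' W p (d⁻¹ * σ)).mp (by rw [map_mul, map_inv, hd, inv_mul_cancel])
    have hres : absRestrictNormalHom L σ = absRestrictNormalHom L d := by
      rw [map_mul, map_inv, inv_mul_eq_one] at hker
      exact hker.symm
    rw [hres, hPdef]
    have hd𝔓 : d • 𝔓 = 𝔓 := hdD
    set y : absIntegers (𝓞 ℚ) ℚ := ι x with hy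
    have hx' : y ∈ 𝔓 := (Ideal.mem_comap).mp hx
    have hdy : d • y ∈ 𝔓 := by
      have := Ideal.smul_mem_pointwise_smul d y 𝔓 hx'
      rwa [hd𝔓] at this
    have hιx : ι (absRestrictNormalHom L d • x) = d • y := by
      apply Subtype.ext
      rw [integralClosure.coe_smul, coe_ringOfIntegersToIntegralClosure, hy,
        coe_ringOfIntegersToIntegralClosure]
      exact hcoe d (x : L)
    have h3 : ι (absRestrictNormalHom L d • x) ∈ 𝔓 := by rw [hιx]; exact hdy
    exact Ideal.mem_comap.mpr h3
  have hstab : ∀ g : L ≃ₐ[ℚ] L, g • P = P := by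
    intro g
    ext x
    rw [Ideal.mem_pointwise_smul_iff_inv_smul_mem]
    constructor
    · intro h
      have := key g _ h
      rwa [smul_inv_smul] at this
    · intro h
      exact key g⁻¹ x h
  -- the witness and uniqueness by transitivity
  refine ⟨⟨P, hPprime, hP0⟩, hpP, fun w hw ↦ ?_⟩
  haveI : w.asIdeal.IsPrime := w.isPrime
  have hwover : w.asIdeal.LiesOver v.asIdeal := by
    constructor
    haveI : (w.asIdeal.under (𝓞 ℚ)).IsPrime := Ideal.IsPrime.under (𝓞 ℚ) w.asIdeal
    have hmem : ((p : ℕ) : 𝓞 ℚ) ∈ w.asIdeal.under (𝓞 ℚ) := by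
      rw [Ideal.under_def, Ideal.mem_comap, map_natCast]; exact hw
    have hne : w.asIdeal.under (𝓞 ℚ) ≠ ⊥ := fun h ↦ by
      rw [h, Ideal.mem_bot] at hmem
      exact hp.ne_zero (by exact_mod_cast hmem)
    set u : HeightOneSpectrum (𝓞 ℚ) := ⟨w.asIdeal.under (𝓞 ℚ), inferInstance, hne⟩ with hu
    have hueq : u = v := by
      rw [hvdef]; exact (natCast_mem_asIdeal_iff_eq_primesEquiv_symm u hp).mp hmem
    exact (congrArg HeightOneSpectrum.asIdeal hueq).symm
  haveI := hwover
  haveI : Module.Finite (𝓞 ℚ) (𝓞 L) := IsIntegralClosure.finite (𝓞 ℚ) ℚ L (𝓞 L)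
  haveI : IsGaloisGroup (L ≃ₐ[ℚ] L) (𝓞 ℚ) (𝓞 L) :=
    IsGaloisGroup.of_isFractionRing (L ≃ₐ[ℚ] L) (𝓞 ℚ) (𝓞 L) ℚ L
  obtain ⟨g, hg⟩ := Algebra.IsInvariant.exists_smul_of_under_eq (𝓞 ℚ) (𝓞 L) (L ≃ₐ[ℚ] L) P
    w.asIdeal (hPover.over.symm.trans hwover.over)
  rw [hstab g] at hg
  exact HeightOneSpectrum.ext hg

/-! ### §7d. At the leaf X8 ∩ {¬ surj(3)}: the binder of Iwasawa 1956 and the composed Conj-A reading -/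

/-- **X8 ∧ `ρ̄_{E,3}` not onto ⟹ `ℚ(E[3])` has EXACTLY ONE prime above `3`** — the `hv` hypothesis of
`IwasawaTheory.iwasawa1956_classNumberPExp_eq_zero_of_not_dvd_classNumber_of_unique_prime` at
`K = W.divisionField 3`, verbatim (decomposition group `= C_ns⁺(3)` of order `16 = [ℚ(E[3]) : ℚ]`;
`e = 8`, `f = 2`).  On the 156 surjective cells of X8 this FAILS (three primes above `3`).
[cite: Serre1972, §1.11 Prop. 12 d) (p. 275)] [cite: Greenberg2001IwasawaPastPresent, Prop. 2.1 p. 339 (the hypothesis served)] -/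
theorem ClassX8.existsUnique_prime_divisionField_of_not_surj (hX : ClassX8 W p) (hns : ¬ Surj W p) :
    ∃! w : HeightOneSpectrum (𝓞 (W.divisionField p)),
      ((p : ℕ) : 𝓞 (W.divisionField p)) ∈ w.asIdeal :=
  existsUnique_prime_divisionField_of_goodSS_of_not_surj W p (ClassX8.p_ne_two W p hX)
    (ClassX8.goodSS W p hX) hns

/-- **X8 ∧ `ρ̄_{E,3}` not onto ∧ `3 ∤ h(ℚ(E[3]))` ⟹ classical Iwasawa `μ = 0` (indeed `A_n = 0` for all
`n`) for EVERY `ℤ₃`-extension of `ℚ(E[3])`** — Iwasawa 1956 / Greenberg Prop. 2.1 (tree THEOREM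
`iwasawa1956_…_holds`, reading aid `classicalMuVanishes_of_classNumberPExp_eq_zero`) with its
unique-prime hypothesis discharged by `ClassX8.existsUnique_prime_divisionField_of_not_surj`; the
class-number hypothesis is the per-cell certificate.
[cite: Greenberg2001IwasawaPastPresent, Prop. 2.1 p. 339] [cite: Lang1990, Ch. 5 §4 Thm. 4.3] -/
theorem ClassX8.classicalMuVanishes_divisionField_of_not_surj_of_not_dvd_classNumber (hX : ClassX8 W p)
    (hns : ¬ Surj W p)
    (hh : haveI : NeZero p := ⟨(Fact.out : p.Prime).ne_zero⟩
      haveI : NumberField (W.divisionField p) := NumberField.mk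
      ¬ p ∣ NumberField.classNumber (W.divisionField p)) :
    haveI : NeZero p := ⟨(Fact.out : p.Prime).ne_zero⟩
    ∀ κL : ZpExtension (W.divisionField p) p, ClassicalMuVanishes κL := by
  haveI : NeZero p := ⟨(Fact.out : p.Prime).ne_zero⟩
  haveI : NumberField (W.divisionField p) := NumberField.mk
  intro κL
  exact classicalMuVanishes_of_classNumberPExp_eq_zero
    iwasawa1956_classNumberPExp_eq_zero_of_not_dvd_classNumber_of_unique_prime_holds hh
    (ClassX8.existsUnique_prime_divisionField_of_not_surj W p hX hns) κL

/-- **X8 ∧ `ρ̄_{E,3}` not onto ⟹ `#Gal(ℚ(E[3])/ℚ) = 16`** (`= #C_ns⁺(3) = 2(3² − 1)`).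
[cite: Serre1972, §1.11 Prop. 12, §2.2] -/
theorem ClassX8.card_aut_divisionField_of_not_surj (hX : ClassX8 W p) (hns : ¬ Surj W p) :
    Nat.card (W.divisionField p ≃ₐ[ℚ] W.divisionField p) = 16 := by
  rw [card_aut_divisionField_eq_card_range, card_range_galoisRepTorsion_of_goodSS_of_not_surj W p
    (ClassX8.p_ne_two W p hX) (ClassX8.goodSS W p hX) hns, hX.1]
  norm_num

/-- **X8 ∧ `ρ̄_{E,3}` not onto ⟹ `3 ∤ #Gal(ℚ(E[3])/ℚ)`** — p2 g2's TURNKEY (b) (16:29:30Z): hypothesis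
(c1) of Deo–Ray–Sujatha 2023 Thm. 3.8/3.9 in the class-number fact's binder shape
`¬ p ∣ Nat.card (ℚ(E[p]) ≃ₐ[ℚ] ℚ(E[p]))`, binder-free on the 61 cells.
[cite: DeoRaySujatha2023, §5 Lemma 5.1 (p. 17)] [cite: Serre1972, §1.11 Prop. 12] -/
theorem ClassX8.not_dvd_card_aut_divisionField_of_not_surj (hX : ClassX8 W p) (hns : ¬ Surj W p) :
    ¬ p ∣ Nat.card (W.divisionField p ≃ₐ[ℚ] W.divisionField p) :=
  not_dvd_card_aut_divisionField_of_goodSS_of_not_surj W p (ClassX8.p_ne_two W p hX)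
    (ClassX8.goodSS W p hX) hns

end Summit.BirchSwinnertonDyer.Rank1Residual.Supersingular

end
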